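import Summits.AnomalousDissipation.AnomalousDissipation.Theorems.SolenoidalFractalHomogenisationLagrangianStepVmodFastSlowAssembly
import Summits.AnomalousDissipation.AnomalousDissipation.Theorems.SolenoidalFractalHomogenisationLagrangianStepVmodFastModeGenerator
import Summits.AnomalousDissipation.AnomalousDissipation.Theorems.SolenoidalFractalHomogenisationLagrangianStepVmodLeakSlow
import Summits.AnomalousDissipation.AnomalousDissipation.Theorems.SolenoidalFractalHomogenisationLagrangianStepVmodFlatPointwise
import Literature.Analysis.FluidPDE.DriftMildBootstrap
import Literature.NumberTheory.LFunctions.PrimeReciprocalWindows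
import HarnessLib

/-!
# K1L_D (stmt-AnomalousDissipation-27980), (V_mod) flat stage (ℓ2): the (fs) block — FAST datum, SLOW nonzero test — in loss currency on EVERY window
# beyond the fast saturation time, at carrier phase 0, via `min(generator, leak, trivial)` mode by mode (certifier table §4 (fs), rows «τ⋆ ≤ τ» as far
# as NO DECAY is needed; prover ad-k1loc-p3 g10, `--supports 27980 --as helper`)

Per slow label `ℓ ≠ 0` and fast class-pair datum `f`: GENERATOR `‖𝓕(U f)(ℓ)‖ ≤ τ·Γ_ℓ‖f‖` (`norm_fc_apply_le_of_fast`), LEAK `≤ G_ℓe^{g_ℓτ}‖f‖`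
(`VmodGen.norm_fc_slow_le_of_fast`, prover ad-sawtooth-k1loc-p1 g15; phase 0), TRIVIAL `≤ ‖f‖`.  On an UNSATURATED mode (`y_ℓ = 8π²·loT·|ℓ|²·τ ≤ 1`, so
`e^{g_ℓτ} ≤ e^{g⋆}`, `g⋆ = 9k²Λ²/(4π⁴c·lo²)` uniform) `min(τΓ_ℓ, G_ℓe^{g_ℓτ}) ≤ √(τΓ_ℓG_ℓe^{g⋆}) ≤ η_u√(y_ℓ/2)`, `η_u² = 3k(3k + π²(hiΛ + β/2))Λ²e^{g⋆}/(π⁴c·lo²)`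
(τ CANCELS, `min_gen_leak_le`); on a SATURATED mode the trivial bound is `≤ √2·√(1 − e^{−y_ℓ})`.  The class-pair assembly
`abs_inner_sub_le_sqrt_of_fast_modewise` (p713117) and the currency (`sum_weight_le_lossAdj`; `lossFwd_ge_of_supp` on the saturated fast datum) give
`fs_pairing_le_of_phase_window`: for `x` fast, `ζ` slow without mean, `cellField(s + ·) = cellField`, `1 ≤ 8π²·loT·⌊n/4⌋²·(t − s)`:
`|⟪U s t x − T s t x, ζ⟫| ≤ 2·√(η_u² + 2)·√(lossFwd (T s t) x)·√(lossAdj (T s t) ζ)` — free of ν, n, labels, window.  With `…VmodFsShortWindow` (τ ≤ τ⋆)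
this is (fs) on all windows at phase 0 with a NON-DECAYING constant; the decaying rows (τ ≫ P: (V)-iterated / W7) and the mean of the test are NOT here.
NOT a proof of `Bfs_textEVH`, of `stub_Vmod_EHT`, of K1L_D or of AD; rung F-D1.A0.
-/

set_option linter.dupNamespace false

noncomputable section

namespace Summit.AnomalousDissipation.AnomalousDissipation.Theorems.SolenoidalFractalHomogenisation.LagrangianStep.VmodFlat

open Literature.Analysis Literature.Analysis.FluidPDE Literature.Analysis.FunctionSpaces
open MeasureTheory Set Filter UnitAddTorus
open scoped ENNReal NNReal InnerProductSpace
open Summit.AnomalousDissipation.AnomalousDissipation.Theorems.SolenoidalFractalHomogenisation.LagrangianStep.CellClauseMod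
open Summit.AnomalousDissipation.AnomalousDissipation.Theorems.SolenoidalFractalHomogenisation.LagrangianStep.LossCurrency
open Summit.AnomalousDissipation.AnomalousDissipation.Theorems.SolenoidalFractalHomogenisation.RealisedQuasiStaticCellLaw
  (isSmooth_cell isDivFree_cell memLp_top_stLift_cell)

/-! ## §1 Elementary -/

/-- `1/2 ≤ 1 − e^{−y}` for `1 ≤ y` (`e^{−1} < 1/2`). [folklore] -/
theorem half_le_one_sub_exp_neg_of_one_le {y : ℝ} (hy : 1 ≤ y) : 1 / 2 ≤ 1 - Real.exp (-y) := by
  have h1 : Real.exp (-y) ≤ Real.exp (-1) := Real.exp_le_exp.2 (by linarith)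
  have h2 : Real.exp (-1) < 1 / 2 := by
    have := Real.exp_one_gt_d9
    rw [Real.exp_neg]
    rw [inv_lt_comm₀ (Real.exp_pos 1) (by norm_num)]
    linarith
  linarith

/-! ## §2 The per-mode `min(generator, leak)` on an unsaturated mode is `τ`-free -/

/-- **The crossover algebra**: with `a·τ` (generator) and `b·e^{gτ}` (leak), on a window where `c·τ ≤ 1` (unsaturated mode) and `g ≤ g⋆·c`:
`min (aτ) (b e^{gτ}) ≤ √(a·b·e^{g⋆}/c) · √(c·τ)`. [folklore] -/
theorem min_gen_leak_le {a b g gs c τ : ℝ} (ha : 0 ≤ a) (hb : 0 ≤ b) (hc : 0 < c) (hτ : 0 ≤ τ) (hcτ : c * τ ≤ 1)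
    (hg0 : 0 ≤ g) (hg : g ≤ gs * c) :
    min (a * τ) (b * Real.exp (g * τ)) ≤ Real.sqrt (a * b * Real.exp gs / c) * Real.sqrt (c * τ) := by
  have hexp : Real.exp (g * τ) ≤ Real.exp gs := Real.exp_le_exp.2 (by nlinarith)
  have h1 : min (a * τ) (b * Real.exp (g * τ)) ≤ Real.sqrt ((a * τ) * (b * Real.exp (g * τ))) :=
    Literature.Analysis.FluidPDE.min_le_sqrt_mul (by positivity) (by positivity)
  refine h1.trans ?_
  rw [← Real.sqrt_mul (by positivity)]
  apply Real.sqrt_le_sqrt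
  have e : a * b * Real.exp gs / c * (c * τ) = (a * τ) * (b * Real.exp gs) := by field_simp
  rw [e]
  exact mul_le_mul_of_nonneg_left (mul_le_mul_of_nonneg_left hexp hb) (by positivity)

/-! ## §3 The (fs) block beyond the fast saturation time, at carrier phase 0 -/

set_option maxHeartbeats 3200000 in
/-- **(fs) IN LOSS CURRENCY ON EVERY WINDOW BEYOND THE FAST SATURATION TIME, AT CARRIER PHASE 0** (`min(generator, leak, trivial)` mode by mode
through `abs_inner_sub_le_sqrt_of_fast_modewise`): for `x` fast, `ζ` slow without mean (`IsSlowNZ`), `cellField(s + ·) = cellField` and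
`1 ≤ 8π²·loT·⌊n/4⌋²·(t − s)`,
`|⟪U s t x − T s t x, ζ⟫| ≤ 2·√(3k(3k + π²(hiΛ + β/2))Λ²·exp(9k²Λ²/(4π⁴c·lo²))/(π⁴c·lo²) + 2) · √(lossFwd (T s t) x) · √(lossAdj (T s t) ζ)`. -/
theorem fs_pairing_le_of_phase_window {k : ℕ} (W : LatticeShear.LatticeWord k) (M : ℝ) (hM : 0 < M) {c : ℝ} (hc : 0 < c)
    (Φ : ℝ → Torus.Visc4 (Fin 3) → Torus.Visc4 (Fin 3)) {lo hi Λ β ν₀ K : ℝ}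
    (hlo : 0 < lo) (hhi : 1 ≤ hi) (hΛ : 1 < Λ) (hβ : 0 ≤ β) (hν₀ : ν₀ ≤ 1) (hK : 0 < K)
    {ν : ℝ} (hν : ν ∈ Set.Ioo 0 ν₀) {n : ℕ} (hn : (⌈K / ν⌉₊ : ℝ) ≤ n) {𝔸 : Torus.Visc4 (Fin 3)}
    (hodd : Torus.OddSmall 𝔸 (ν * β)) (hwin : ∃ lam ∈ Set.Icc (1:ℝ) Λ, Torus.NearIso 𝔸 (ν * (lo / lam)) (ν * (hi * lam)))
    (hΦw : ∃ lam ∈ Set.Icc (1:ℝ) Λ, Torus.NearIso (Φ ν ((1 / ν) • 𝔸)) (lo / lam) (hi * lam))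
    {Tw : ℝ} {U T : ℝ → ℝ → (V2 →L[ℝ] V2)}
    (hU : Torus.IsPropagator Tw (cellField W M hM ν hν.1 n) ((1 / (n:ℝ) ^ 2) • 𝔸) U)
    (hT : Torus.IsPropagator Tw (fun _ _ => 0) ((1 / (n:ℝ) ^ 2) • (𝔸 + (c / ν) • Φ ν ((1 / ν) • 𝔸))) T)
    {s t : ℝ} (hs : 0 ≤ s) (hst : s < t) (htT : t ≤ Tw)
    (hphase : ∀ τ, cellField W M hM ν hν.1 n (s + τ) = cellField W M hM ν hν.1 n τ)
    (x ζ : V2) (hx : IsFast n x) (hζ : IsSlowNZ n ζ)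
    (hsat : 1 ≤ 8 * Real.pi ^ 2 * loT lo Λ c ν n * ((n / 4 : ℕ) : ℝ) ^ 2 * (t - s)) :
    |⟪U s t x - T s t x, ζ⟫_ℝ|
      ≤ 2 * Real.sqrt (3 * k * (3 * k + Real.pi ^ 2 * (hi * Λ + β / 2)) * Λ ^ 2 * Real.exp (9 * (k:ℝ) ^ 2 * Λ ^ 2 / (4 * Real.pi ^ 4 * c * lo ^ 2))
            / (Real.pi ^ 4 * c * lo ^ 2) + 2)
          * Real.sqrt (lossFwd (T s t) x) * Real.sqrt (lossAdj (T s t) ζ) := by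
  classical
  have hn1 : (1:ℝ) ≤ n := by
    have h1 : (1:ℝ) ≤ ⌈K / ν⌉₊ := by
      have : 0 < K / ν := div_pos hK hν.1
      exact_mod_cast Nat.one_le_iff_ne_zero.2 (Nat.pos_iff_ne_zero.1 (Nat.ceil_pos.2 this))
    exact h1.trans hn
  have hnpos : 0 < n := by exact_mod_cast (show (0:ℝ) < n by linarith)
  have hn0 : (0:ℝ) < n := by exact_mod_cast hnpos
  have hν0 : 0 < ν := hν.1
  have hν1 : ν ≤ 1 := hν.2.le.trans hν₀
  have hΛ0 : 0 < Λ := by linarith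
  have hΛ1 : 1 ≤ Λ := hΛ.le
  have hhi0 : 0 ≤ hi := by linarith
  have hts : 0 < t - s := sub_pos.2 hst
  have hsT : s < Tw := lt_of_lt_of_le hst htT
  set N₄ : ℕ := n / 4 with hN₄
  set S : Finset (Fin 3 → ℤ) := (Torus.freqBall (d := Fin 3) (n / 4)).erase 0 with hS
  have hLN : 2 * (n / 4) < n := by omega
  obtain ⟨lam, hlam, hA𝔸⟩ := hwin
  obtain ⟨lam', hlam', hΦn⟩ := hΦw
  have hlam0 : 0 < lam := by linarith [hlam.1]
  have hlam'0 : 0 < lam' := by linarith [hlam'.1]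
  have hcν : 0 ≤ c / ν := div_nonneg hc.le hν0.le
  have hn2 : (0:ℝ) < 1 / (n:ℝ) ^ 2 := by positivity
  have hAΛ : Torus.NearIso 𝔸 (ν * (lo / Λ)) (ν * (hi * Λ)) :=
    hA𝔸.mono (mul_le_mul_of_nonneg_left (div_le_div_of_nonneg_left hlo.le hlam0 hlam.2) hν0.le)
      (mul_le_mul_of_nonneg_left (mul_le_mul_of_nonneg_left hlam.2 hhi0) hν0.le)
  have hloA : 0 < ν * (lo / Λ) := mul_pos hν0 (div_pos hlo hΛ0)
  have hcell : Torus.NearIso ((1 / (n:ℝ) ^ 2) • 𝔸) ((1 / (n:ℝ) ^ 2) * (ν * (lo / Λ))) ((1 / (n:ℝ) ^ 2) * (ν * (hi * Λ))) := hAΛ.smul hn2.le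
  have hcell_lo : 0 < (1 / (n:ℝ) ^ 2) * (ν * (lo / Λ)) := mul_pos hn2 hloA
  have hcoarse0 : Torus.NearIso ((1 / (n:ℝ) ^ 2) • (𝔸 + (c / ν) • Φ ν ((1 / ν) • 𝔸)))
      ((1 / (n:ℝ) ^ 2) * (ν * (lo / lam) + (c / ν) * (lo / lam'))) ((1 / (n:ℝ) ^ 2) * (ν * (hi * lam) + (c / ν) * (hi * lam'))) :=
    (hA𝔸.add (hΦn.smul hcν)).smul hn2.le
  have hloT_le : loT lo Λ c ν n ≤ (1 / (n:ℝ) ^ 2) * (ν * (lo / lam) + (c / ν) * (lo / lam')) := by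
    unfold loT
    have h1 : lo / Λ ≤ lo / lam := div_le_div_of_nonneg_left hlo.le hlam0 hlam.2
    have h2 : lo / Λ ≤ lo / lam' := div_le_div_of_nonneg_left hlo.le hlam'0 hlam'.2
    have h3 : (ν + c / ν) * (lo / Λ) ≤ ν * (lo / lam) + (c / ν) * (lo / lam') := by
      have := mul_le_mul_of_nonneg_left h1 hν0.le
      have := mul_le_mul_of_nonneg_left h2 hcν
      nlinarith
    exact mul_le_mul_of_nonneg_left h3 hn2.le
  have hloT : 0 < loT lo Λ c ν n := by
    unfold loT
    have hνc : 0 < ν + c / ν := by positivity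
    exact mul_pos hn2 (mul_pos hνc (div_pos hlo hΛ0))
  have hcoarse : Torus.NearIso ((1 / (n:ℝ) ^ 2) • (𝔸 + (c / ν) • Φ ν ((1 / ν) • 𝔸)))
      (loT lo Λ c ν n) ((1 / (n:ℝ) ^ 2) * (ν * (hi * lam) + (c / ν) * (hi * lam'))) := hcoarse0.mono hloT_le le_rfl
  set L : ℝ := loT lo Λ c ν n with hLdef
  have hLc : (c / ν) * (lo / Λ) / (n:ℝ) ^ 2 ≤ L := by
    rw [hLdef]; unfold loT
    rw [div_eq_mul_one_div ((c / ν) * (lo / Λ)) ((n:ℝ) ^ 2), mul_comm ((c / ν) * (lo / Λ))]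
    refine mul_le_mul_of_nonneg_left ?_ hn2.le
    have : 0 ≤ ν * (lo / Λ) := by positivity
    nlinarith
  have hbU : MemLp (Torus.stLift (cellField W M hM ν hν.1 n)) ∞ (volume.restrict (Ioo 0 Tw ×ˢ (univ : Set (EuclideanSpace ℝ (Fin 3))))) :=
    memLp_top_stLift_cell _ n Tw
  have hbUdiv : ∀ᵐ τ ∂(volume.restrict (Ioo (0:ℝ) Tw)), Torus.IsWeaklyDivFree (cellField W M hM ν hν.1 n τ) :=
    ae_of_all _ fun τ => (isDivFree_cell _ n τ).isWeaklyDivFree_holds (isSmooth_cell _ n τ)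
  have hgrid : ∀ (j : Fin 3 → Fin n) (τ : ℝ) (y : UnitAddTorus (Fin 3)),
      cellField W M hM ν hν.1 n τ (y + (fun i => ((((j i : ℕ) : ℝ) / n : ℝ) : UnitAddCircle))) = cellField W M hM ν hν.1 n τ y :=
    fun j τ y => by unfold cellField; exact cell_add_grid _ hnpos j τ y
  have hUcl : ∀ (c' : Fin 3 → ℤ) (y : V2), (∀ k', ((∀ i, (n:ℤ) ∣ k' i - c' i) ∨ (∀ i, (n:ℤ) ∣ k' i + c' i)) →
        mFourierCoeff (EuclideanSpace.complexify ∘ ⇑y) k' = 0) →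
      ∀ k', ((∀ i, (n:ℤ) ∣ k' i - c' i) ∨ (∀ i, (n:ℤ) ∣ k' i + c' i)) →
        mFourierCoeff (EuclideanSpace.complexify ∘ ⇑(U s t y)) k' = 0 :=
    fun c' y hy k' hk' => PropagatorSymm.fcoeff_apply_eq_zero_of_classes hU hcell hcell_lo hbU hbUdiv hnpos hgrid c' hs hst.le htT y hy k' hk'
  have hTmode : ∀ (y : V2) (k' : Fin 3 → ℤ), mFourierCoeff (EuclideanSpace.complexify ∘ ⇑y) k' = 0 →
      mFourierCoeff (EuclideanSpace.complexify ∘ ⇑(T s t y)) k' = 0 :=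
    fun y k' hk' => fc_propagator_eq_zero hcoarse hloT (fun _ _ => rfl) hT hs hst.le htT y hk'
  have halone : ∀ ℓ ∈ S, ∀ k' ∈ S, ((∀ i, (n:ℤ) ∣ k' i - ℓ i) ∨ (∀ i, (n:ℤ) ∣ k' i + ℓ i)) → k' = ℓ ∨ k' = -ℓ :=
    fun ℓ hℓ k' hk' hpair => FlatWindow.alone_of_lt hLN (Finset.mem_of_mem_erase hℓ) (Finset.mem_of_mem_erase hk') hpair
  have hnsc : ∀ ℓ ∈ S, ¬ (∀ i, (n:ℤ) ∣ ℓ i + ℓ i) :=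
    fun ℓ hℓ => FlatWindow.not_selfConj_of_lt hLN (Finset.mem_of_mem_erase hℓ) (Finset.ne_of_mem_erase hℓ)
  have hSneg : ∀ k' ∈ S, -k' ∈ S := fun k' hk' =>
    Finset.mem_erase.2 ⟨neg_ne_zero.2 (Finset.ne_of_mem_erase hk'), Torus.neg_mem_freqBall.2 (Finset.mem_of_mem_erase hk')⟩
  set A : ℝ := 6 * Real.pi * ((k:ℝ) / (2 * Real.pi * (n:ℝ))) +
      4 * Real.pi ^ 2 * ((1 / (n:ℝ) ^ 2) * (ν * (hi * Λ)) + (1 / (n:ℝ) ^ 2) * (ν * β) / 2) * (N₄:ℝ) with hAdef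
  have hA0 : 0 ≤ A := by positivity
  set Gl : (Fin 3 → ℤ) → ℝ := fun ℓ => 12 * k * (Real.sqrt (Torus.freqNormSq ℓ) / n) / (Real.pi ^ 2 * (ν * (lo / Λ))) with hGl
  set gl : (Fin 3 → ℤ) → ℝ := fun ℓ => 18 * (k : ℝ) ^ 2 * (Torus.freqNormSq ℓ / (n : ℝ) ^ 2) / (Real.pi ^ 2 * (ν * (lo / Λ))) with hgl
  set ε : (Fin 3 → ℤ) → ℝ := fun ℓ => min (min ((t - s) * A * Real.sqrt (Torus.freqNormSq ℓ)) (Gl ℓ * Real.exp (gl ℓ * (t - s)))) 1 with hεdef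
  have hε0 : ∀ ℓ, 0 ≤ ε ℓ := fun ℓ => by
    rw [hεdef]
    refine le_min (le_min (by positivity) ?_) zero_le_one
    have : 0 ≤ Gl ℓ := by rw [hGl]; positivity
    positivity
  have hphase' : ∀ τ, ((W.stretch M hM).stretch (1 / ν) (one_div_pos.mpr hν.1)).cell n (s + τ)
      = ((W.stretch M hM).stretch (1 / ν) (one_div_pos.mpr hν.1)).cell n τ := hphase
  have hleak : ∀ ℓ ∈ S, ∀ v : V2, v ∈ Torus.divFreeL2 (Fin 3) →
      (∀ k', ¬ ((∀ i, (n:ℤ) ∣ k' i - ℓ i) ∨ (∀ i, (n:ℤ) ∣ k' i + ℓ i)) → mFourierCoeff (EuclideanSpace.complexify ∘ ⇑v) k' = 0) →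
      mFourierCoeff (EuclideanSpace.complexify ∘ ⇑v) ℓ = 0 → mFourierCoeff (EuclideanSpace.complexify ∘ ⇑v) (-ℓ) = 0 →
      ‖mFourierCoeff (EuclideanSpace.complexify ∘ ⇑(U s t v)) ℓ‖ ≤ ε ℓ * ‖v‖ := by
    intro ℓ hℓ v hv hvs hv1 hv2
    have hℓball : ℓ ∈ Torus.freqBall (d := Fin 3) (n / 4) := Finset.mem_of_mem_erase hℓ
    have hℓ0 : ℓ ≠ 0 := Finset.ne_of_mem_erase hℓ
    have hvfast : IsFast n v := by
      intro k' hk'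
      by_cases hcp : (∀ i, (n:ℤ) ∣ k' i - ℓ i) ∨ (∀ i, (n:ℤ) ∣ k' i + ℓ i)
      · rcases FlatWindow.alone_of_lt hLN hℓball hk' hcp with h | h
        · rw [h]; exact hv1
        · rw [h]; exact hv2
      · exact hvs k' hcp
    have hgen : ‖fc (U s t v) ℓ‖ ≤ (t - s) * A * Real.sqrt (Torus.freqNormSq ℓ) * ‖v‖ :=
      norm_fc_apply_le_of_fast W M hM hlo hhi0 hΛ1 hβ hν.1 hnpos hodd ⟨lam, hlam, hA𝔸⟩ hU hs hst.le htT v hvfast hℓball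
    have hℓn : 2 * Real.sqrt (Torus.freqNormSq ℓ) < n := by
      have h1 : Real.sqrt (Torus.freqNormSq ℓ) ≤ (N₄ : ℝ) := by
        rw [← Real.sqrt_sq (Nat.cast_nonneg N₄)]
        exact Real.sqrt_le_sqrt (Torus.mem_freqBall.1 hℓball)
      have h2 : (2:ℝ) * N₄ < n := by exact_mod_cast hLN
      linarith
    have hlk := VmodGen.norm_fc_slow_le_of_fast ((W.stretch M hM).stretch (1 / ν) (one_div_pos.mpr hν.1)) (Nat.pos_iff_ne_zero.1 hnpos)
      hAΛ hloA hU hs hst.le htT hsT hphase' hℓ0 hℓn v ((Torus.mem_divFreeL2_iff _).1 hv)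
      (fun k' hk' => by by_contra hcp; exact hk' (hvs k' hcp)) hv1 hv2
    have htriv : ‖fc (U s t v) ℓ‖ ≤ 1 * ‖v‖ := by
      rw [one_mul]
      have hB := sum_norm_sq_fcoeff_le {ℓ} (U s t v)
      rw [Finset.sum_singleton] at hB
      have h2 : ‖fc (U s t v) ℓ‖ ≤ ‖U s t v‖ := by
        calc ‖fc (U s t v) ℓ‖ = Real.sqrt (‖fc (U s t v) ℓ‖ ^ 2) := (Real.sqrt_sq (norm_nonneg _)).symm
          _ ≤ Real.sqrt (‖U s t v‖ ^ 2) := Real.sqrt_le_sqrt hB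
          _ = ‖U s t v‖ := Real.sqrt_sq (norm_nonneg _)
      exact h2.trans (hU.norm_le s t v)
    show ‖fc (U s t v) ℓ‖ ≤ ε ℓ * ‖v‖
    rw [hεdef]
    simp only
    rw [min_mul_of_nonneg _ _ (norm_nonneg v), min_mul_of_nonneg _ _ (norm_nonneg v)]
    refine le_min (le_min hgen ?_) htriv
    have e : Gl ℓ * Real.exp (gl ℓ * (t - s)) * ‖v‖ = (12 * k * (Real.sqrt (Torus.freqNormSq ℓ) / n) / (Real.pi ^ 2 * (ν * (lo / Λ)))) *
        Real.exp (18 * (k : ℝ) ^ 2 * (Torus.freqNormSq ℓ / (n : ℝ) ^ 2) * (t - s) / (Real.pi ^ 2 * (ν * (lo / Λ)))) * ‖v‖ := by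
      simp only [hGl, hgl]
      congr 3
      ring
    rw [e]
    exact hlk
  set gs : ℝ := 9 * (k:ℝ) ^ 2 * Λ ^ 2 / (4 * Real.pi ^ 4 * c * lo ^ 2) with hgs
  set ηu2 : ℝ := 3 * k * (3 * k + Real.pi ^ 2 * (hi * Λ + β / 2)) * Λ ^ 2 * Real.exp gs / (Real.pi ^ 4 * c * lo ^ 2) with hηu2
  have hηu2_0 : 0 ≤ ηu2 := by positivity
  set η : ℝ := Real.sqrt (ηu2 + 2) with hηdef
  have hη0 : 0 ≤ η := Real.sqrt_nonneg _
  have hη2 : η ^ 2 = ηu2 + 2 := Real.sq_sqrt (by positivity)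
  set d : (Fin 3 → ℤ) → ℝ := fun ℓ => dW lo Λ c ν n (t - s) ℓ with hddef
  have hd0 : ∀ ℓ, 0 ≤ d ℓ := fun ℓ => by
    rw [hddef]; unfold dW
    have : Real.exp (-(8 * Real.pi ^ 2 * loT lo Λ c ν n * Torus.freqNormSq ℓ * (t - s))) ≤ 1 := by
      apply Real.exp_le_one_iff.2
      have := Torus.freqNormSq_nonneg ℓ
      have : 0 ≤ 8 * Real.pi ^ 2 * loT lo Λ c ν n * Torus.freqNormSq ℓ * (t - s) := by positivity
      linarith
    linarith
  have hεd : ∀ ℓ ∈ S, ε ℓ ≤ η * Real.sqrt (d ℓ) := by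
    intro ℓ hℓ
    have hf0 : 0 ≤ Torus.freqNormSq ℓ := Torus.freqNormSq_nonneg ℓ
    set y : ℝ := 8 * Real.pi ^ 2 * L * Torus.freqNormSq ℓ * (t - s) with hy
    have hy0 : 0 ≤ y := by positivity
    have hdy : d ℓ = 1 - Real.exp (-y) := by rw [hddef]; unfold dW; rw [hy]
    by_cases hsat1 : y ≤ 1
    · -- unsaturated: `min(generator, leak) ≤ √(gen·leak·e^{g⋆}/c₁)·√(c₁ τ)` with `c₁ = 8π²L|ℓ|²`
      have hyd : y / 2 ≤ d ℓ := by rw [hdy]; exact Literature.NumberTheory.LFunctions.PrimeReciprocal.half_le_one_sub_exp_neg hy0 hsat1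
      have hfpos : 0 < Torus.freqNormSq ℓ := by
        rcases (Torus.freqNormSq_nonneg ℓ).eq_or_lt with h | h
        · exfalso
          refine Finset.ne_of_mem_erase hℓ ?_
          funext i
          have hsum : Torus.freqNormSq ℓ = ∑ j, ((ℓ j : ℝ)) ^ 2 := rfl
          have h0 : ∑ j, ((ℓ j : ℝ)) ^ 2 = 0 := by rw [← hsum, ← h]
          have := (Finset.sum_eq_zero_iff_of_nonneg (fun j _ => sq_nonneg ((ℓ j : ℝ)))).1 h0 i (Finset.mem_univ i)
          exact_mod_cast pow_eq_zero_iff (n := 2) (by norm_num) |>.1 this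
        · exact h
      set c₁ : ℝ := 8 * Real.pi ^ 2 * L * Torus.freqNormSq ℓ with hc₁
      have hc₁0 : 0 < c₁ := by positivity
      have hc₁τ : c₁ * (t - s) ≤ 1 := by rw [hc₁]; rw [hy] at hsat1; linarith
      have hglc : gl ℓ ≤ gs * c₁ := by
        simp only [hgl, hgs, hc₁]
        have hf := hf0
        have hkey : 18 * (k:ℝ) ^ 2 * (Torus.freqNormSq ℓ / (n:ℝ) ^ 2) / (Real.pi ^ 2 * (ν * (lo / Λ)))
            = (9 * (k:ℝ) ^ 2 * Λ ^ 2 / (4 * Real.pi ^ 4 * c * lo ^ 2)) * (8 * Real.pi ^ 2 * ((c / ν) * (lo / Λ) / (n:ℝ) ^ 2) * Torus.freqNormSq ℓ) := by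
          field_simp
          ring
        rw [hkey]
        have : 8 * Real.pi ^ 2 * ((c / ν) * (lo / Λ) / (n:ℝ) ^ 2) * Torus.freqNormSq ℓ ≤ 8 * Real.pi ^ 2 * L * Torus.freqNormSq ℓ := by
          have := mul_le_mul_of_nonneg_right (mul_le_mul_of_nonneg_left hLc (by positivity : (0:ℝ) ≤ 8 * Real.pi ^ 2)) hf
          linarith
        exact mul_le_mul_of_nonneg_left this (by positivity)
      have hGl0 : 0 ≤ Gl ℓ := by rw [hGl]; positivity
      have hmin := min_gen_leak_le (a := A * Real.sqrt (Torus.freqNormSq ℓ)) (b := Gl ℓ) (by positivity) hGl0 hc₁0 hts.le hc₁τ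
        (by rw [hgl]; positivity) hglc
      have hab : A * Real.sqrt (Torus.freqNormSq ℓ) * Gl ℓ * Real.exp gs / c₁ ≤ ηu2 / 2 := by
        have hsf : Real.sqrt (Torus.freqNormSq ℓ) * Real.sqrt (Torus.freqNormSq ℓ) = Torus.freqNormSq ℓ := Real.mul_self_sqrt hf0
        have hN4n : (N₄ : ℝ) ≤ (n:ℝ) / 4 := by
          have h4 : 4 * N₄ ≤ n := Nat.mul_div_le n 4
          have : (4:ℝ) * N₄ ≤ n := by exact_mod_cast h4
          linarith
        have hAn : A * n ≤ 3 * k + Real.pi ^ 2 * (hi * Λ + β / 2) := by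
          rw [hAdef]
          have e1 : (6 * Real.pi * ((k:ℝ) / (2 * Real.pi * (n:ℝ))) +
              4 * Real.pi ^ 2 * ((1 / (n:ℝ) ^ 2) * (ν * (hi * Λ)) + (1 / (n:ℝ) ^ 2) * (ν * β) / 2) * (N₄:ℝ)) * n
              = 3 * k + 4 * Real.pi ^ 2 * (hi * Λ + β / 2) * ((ν * (N₄:ℝ)) / n) := by
            field_simp
            ring
          rw [e1]
          have h4 : ν * (N₄:ℝ) / n ≤ 1 / 4 := by
            rw [div_le_iff₀ hn0]
            calc ν * (N₄:ℝ) ≤ 1 * (N₄:ℝ) := mul_le_mul_of_nonneg_right hν1 (Nat.cast_nonneg _)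
              _ ≤ (n:ℝ) / 4 := by rw [one_mul]; exact hN4n
              _ = 1 / 4 * n := by ring
          have hq : 0 ≤ 4 * Real.pi ^ 2 * (hi * Λ + β / 2) := by positivity
          nlinarith [mul_le_mul_of_nonneg_left h4 hq]
        set Q : ℝ := 12 * k / (Real.pi ^ 2 * (ν * (lo / Λ)) * n) with hQ
        have hGq : Gl ℓ = Q * Real.sqrt (Torus.freqNormSq ℓ) := by simp only [hGl, hQ]; ring
        set c₁' : ℝ := 8 * Real.pi ^ 2 * ((c / ν) * (lo / Λ) / (n:ℝ) ^ 2) * Torus.freqNormSq ℓ with hc₁'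
        have hc₁'0 : 0 < c₁' := by positivity
        have hc₁'le : c₁' ≤ c₁ := by
          rw [hc₁', hc₁]
          exact mul_le_mul_of_nonneg_right (mul_le_mul_of_nonneg_left hLc (by positivity)) hf0
        have eL : A * Real.sqrt (Torus.freqNormSq ℓ) * Gl ℓ * Real.exp gs / c₁ = A * Q * Real.exp gs * (Torus.freqNormSq ℓ / c₁) := by
          rw [hGq, show A * Real.sqrt (Torus.freqNormSq ℓ) * (Q * Real.sqrt (Torus.freqNormSq ℓ))
            = A * Q * (Real.sqrt (Torus.freqNormSq ℓ) * Real.sqrt (Torus.freqNormSq ℓ)) by ring, hsf]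
          ring
        have hfc : Torus.freqNormSq ℓ / c₁ ≤ Torus.freqNormSq ℓ / c₁' := div_le_div_of_nonneg_left hf0 hc₁'0 hc₁'le
        have efc : Torus.freqNormSq ℓ / c₁' = ν * Λ * (n:ℝ) ^ 2 / (8 * Real.pi ^ 2 * c * lo) := by
          rw [hc₁']
          field_simp
        have eR : A * Q * Real.exp gs * (ν * Λ * (n:ℝ) ^ 2 / (8 * Real.pi ^ 2 * c * lo))
            = (A * n) * (3 * k * Λ ^ 2 * Real.exp gs / (2 * Real.pi ^ 4 * c * lo ^ 2)) := by
          rw [hQ]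
          field_simp
          ring
        rw [eL]
        calc A * Q * Real.exp gs * (Torus.freqNormSq ℓ / c₁)
            ≤ A * Q * Real.exp gs * (Torus.freqNormSq ℓ / c₁') := mul_le_mul_of_nonneg_left hfc (by positivity)
          _ = (A * n) * (3 * k * Λ ^ 2 * Real.exp gs / (2 * Real.pi ^ 4 * c * lo ^ 2)) := by rw [efc, eR]
          _ ≤ (3 * k + Real.pi ^ 2 * (hi * Λ + β / 2)) * (3 * k * Λ ^ 2 * Real.exp gs / (2 * Real.pi ^ 4 * c * lo ^ 2)) :=
              mul_le_mul_of_nonneg_right hAn (by positivity)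
          _ = ηu2 / 2 := by rw [hηu2]; ring
      have h1 : ε ℓ ≤ min ((t - s) * A * Real.sqrt (Torus.freqNormSq ℓ)) (Gl ℓ * Real.exp (gl ℓ * (t - s))) := by rw [hεdef]; exact min_le_left _ _
      have h2 : min ((t - s) * A * Real.sqrt (Torus.freqNormSq ℓ)) (Gl ℓ * Real.exp (gl ℓ * (t - s)))
          = min (A * Real.sqrt (Torus.freqNormSq ℓ) * (t - s)) (Gl ℓ * Real.exp (gl ℓ * (t - s))) := by ring_nf
      refine h1.trans ?_
      rw [h2]
      refine hmin.trans ?_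
      have hc₁y : c₁ * (t - s) = y := by rw [hc₁, hy]
      rw [hc₁y, ← Real.sqrt_mul (by positivity)]
      calc Real.sqrt (A * Real.sqrt (Torus.freqNormSq ℓ) * Gl ℓ * Real.exp gs / c₁ * y)
          ≤ Real.sqrt (ηu2 / 2 * y) := Real.sqrt_le_sqrt (mul_le_mul_of_nonneg_right hab hy0)
        _ ≤ Real.sqrt (η ^ 2 * d ℓ) := Real.sqrt_le_sqrt (by rw [hη2]; nlinarith [hyd, hηu2_0, hd0 ℓ])
        _ = η * Real.sqrt (d ℓ) := by rw [Real.sqrt_mul (sq_nonneg _), Real.sqrt_sq hη0]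
    · -- saturated: the trivial bound
      have hyd : 1 / 2 ≤ d ℓ := by rw [hdy]; exact half_le_one_sub_exp_neg_of_one_le (le_of_lt (not_le.1 hsat1))
      have h1 : ε ℓ ≤ 1 := by rw [hεdef]; exact min_le_right _ _
      refine h1.trans ?_
      have h3 : (1:ℝ) ≤ η * Real.sqrt (1 / 2) := by
        rw [hηdef, ← Real.sqrt_mul (by positivity)]
        rw [show (1:ℝ) = Real.sqrt 1 from Real.sqrt_one.symm]
        exact Real.sqrt_le_sqrt (by nlinarith)
      exact h3.trans (mul_le_mul_of_nonneg_left (Real.sqrt_le_sqrt hyd) hη0)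
  have hxS : ∀ k' ∈ S, mFourierCoeff (EuclideanSpace.complexify ∘ ⇑x) k' = 0 := fun k' hk' => hx k' (Finset.mem_of_mem_erase hk')
  have hζS : ∀ k', k' ∉ S → mFourierCoeff (EuclideanSpace.complexify ∘ ⇑ζ) k' = 0 := fun k' hk' => hζ k' hk'
  have key := abs_inner_sub_le_sqrt_of_fast_modewise S (U s t) (T s t) ε hnpos hSneg halone hnsc hε0
    (fun y => hU.apply_eq_apply_starProjection s t y) (fun y => hT.apply_eq_apply_starProjection s t y)
    hUcl hTmode hleak d η hη0 hd0 hεd x ζ hxS hζS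
  have hAζ : ∑ k' ∈ S, d k' * ‖mFourierCoeff (EuclideanSpace.complexify ∘ ⇑ζ) k'‖ ^ 2 ≤ lossAdj (T s t) ζ :=
    sum_weight_le_lossAdj hcoarse hloT hT hs hst.le htT S ζ
  have hFx : (1 / 2) * ‖x‖ ^ 2 ≤ lossFwd (T s t) x := by
    have hsupp : ∀ k', fc x k' ≠ 0 → ((N₄ : ℝ)) ^ 2 ≤ Torus.freqNormSq k' := by
      intro k' hk'
      by_contra hlt
      exact hk' (hx k' (Torus.mem_freqBall.2 (le_of_lt (not_le.1 hlt))))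
    have h := lossFwd_ge_of_supp hcoarse hloT (fun _ _ => rfl) hT hs hst.le htT x (sq_nonneg (N₄ : ℝ)) hsupp
    have he : (1:ℝ) / 2 ≤ 1 - Real.exp (-(8 * Real.pi ^ 2 * L * (N₄:ℝ) ^ 2 * (t - s))) := half_le_one_sub_exp_neg_of_one_le hsat
    exact (mul_le_mul_of_nonneg_right he (sq_nonneg _)).trans h
  have hxle : ‖x‖ ≤ Real.sqrt 2 * Real.sqrt (lossFwd (T s t) x) := by
    rw [← Real.sqrt_mul (by norm_num)]
    calc ‖x‖ = Real.sqrt (‖x‖ ^ 2) := (Real.sqrt_sq (norm_nonneg _)).symm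
      _ ≤ Real.sqrt (2 * lossFwd (T s t) x) := Real.sqrt_le_sqrt (by linarith)
  refine key.trans ?_
  have hs2 : Real.sqrt 2 * Real.sqrt 2 = 2 := Real.mul_self_sqrt (by norm_num)
  calc Real.sqrt 2 * η * ‖x‖ * Real.sqrt (∑ k' ∈ S, d k' * ‖mFourierCoeff (EuclideanSpace.complexify ∘ ⇑ζ) k'‖ ^ 2)
      ≤ Real.sqrt 2 * η * (Real.sqrt 2 * Real.sqrt (lossFwd (T s t) x)) * Real.sqrt (lossAdj (T s t) ζ) :=
        mul_le_mul (mul_le_mul_of_nonneg_left hxle (by positivity)) (Real.sqrt_le_sqrt hAζ) (Real.sqrt_nonneg _) (by positivity)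
    _ = 2 * η * Real.sqrt (lossFwd (T s t) x) * Real.sqrt (lossAdj (T s t) ζ) := by
        rw [show Real.sqrt 2 * η * (Real.sqrt 2 * Real.sqrt (lossFwd (T s t) x)) = (Real.sqrt 2 * Real.sqrt 2) * η * Real.sqrt (lossFwd (T s t) x) by ring, hs2]
    _ = _ := by rw [hηdef, hηu2, hgs]

end Summit.AnomalousDissipation.AnomalousDissipation.Theorems.SolenoidalFractalHomogenisation.LagrangianStep.VmodFlat

end
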